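import Literature.Topology.FourManifolds.GenericFoldChart
import Literature.Topology.FourManifolds.FoldChartSigAssembly
import HarnessLib

/-!
# Fold charts of arbitrary signature at the critical points of a fibred map

Topic `Literature/Topology/FourManifolds` (programme of the fact
`Literature.Topology.FourManifolds.exists_isSimplifiedBrokenLefschetzFibration`, Baykur–Saeki 2017, §2.1:
"all the fold singularities of a simplified broken Lefschetz fibration are indefinite", the
general fold being `(t, ±x² ± y² ± z²)`).  `GenericFoldChart.hasIndefiniteFoldChart_fibredMap`
produced the chart of an INDEFINITE fold point of a fibred map `F = (t, f(t, w))` (nondegenerate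
fibre Hessian taking both signs).  Dropping the sign hypotheses, the same parametric Morse lemma
(critical section, cut-off, fibrewise Morse coordinates, Sylvester index `σ`) gives a fold chart
of signature `(s₁, s₂, s₃)`, `sᵢ = -1` for `i < σ` and `+1` otherwise — covering the DEFINITE
folds (`σ = 0` or `3`) as well:

* `exists_hasFoldChartSig_fibredMap` — at a point where the fibre gradient vanishes and the
  fibre Hessian is nondegenerate, `F` has a fold chart of some signature `(±1, ±1, ±1)`.

Everything is proved; no definitions, no named facts (D-0026).

## References

* R. İ. Baykur, O. Saeki, *Simplifying indefinite fibrations on 4-manifolds*, arXiv:1705.11169,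
  §2.1, p. 6. [BaykurSaeki2017]
* M. W. Hirsch, *Differential Topology*, GTM 33 (1976), Ch. 6 §1 (Morse lemma with
  parameters). [HirschDT1976]
-/

noncomputable section

open Set Function Filter Module
open scoped Topology ContDiff

namespace Literature.Topology.FourManifolds

/-- Local notation: `𝔼 n` is the model Euclidean space `EuclideanSpace ℝ (Fin n)`. -/
local notation "𝔼 " n:arg => EuclideanSpace ℝ (Fin n)

/-- **Fold chart of a fibred map at a nondegenerate fibrewise critical point, any signature.**
Let `F = fibredMap f : (t, w) ↦ (t, f(t, w))` with `f` `C^∞`, and `x` a point where the fibre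
gradient vanishes and the fibre Hessian is nondegenerate (of Sylvester index `σ`).  Then `x` has
a fold chart of signature `(s₁, s₂, s₃)` with `sᵢ = ±1`: `ψ ∘ F = (φ₀, s₁φ₁² + s₂φ₂² + s₃φ₃²)`
— definite when `σ ∈ {0, 3}`, indefinite otherwise (parametric Morse lemma, Hirsch Ch. 6 §1;
Baykur–Saeki §2.1). [cite: BaykurSaeki2017, §2.1] [cite: HirschDT1976, Ch. 6 §1] -/
theorem exists_hasFoldChartSig_fibredMap {f : ℝ × 𝔼 3 → ℝ} (hf : ContDiff ℝ ∞ f) {x : 𝔼 4}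
    (hcrit : fibreGrad f (x 0, fibrePart x) = 0)
    (hH : ∀ a : 𝔼 3, (∀ b, fibreHessian f (x 0, fibrePart x) a b = 0) → a = 0) :
    ∃ s₁ s₂ s₃ : ℝ, s₁ ^ 2 = 1 ∧ s₂ ^ 2 = 1 ∧ s₃ ^ 2 = 1 ∧
      HasFoldChartSig (fibredMap f) x s₁ s₂ s₃ := by
  set t₀ : ℝ := x 0 with ht₀_def
  set w₀ : 𝔼 3 := fibrePart x with hw₀_def
  have h2 : (2 : WithTop ℕ∞) ≤ ∞ := WithTop.coe_le_coe.2 le_top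
  have hsymm : ∀ a b, fibreHessian f (t₀, w₀) a b = fibreHessian f (t₀, w₀) b a := fun a b => by
    simp only [fibreHessian_apply]
    exact (hf.contDiffAt.isSymmSndFDerivAt (by simpa using h2)) _ _
  -- Step 1: the critical section
  have hH' : ∀ a : 𝔼 3, (∀ b, fderiv ℝ (fderiv ℝ f) (t₀, w₀) ((0 : ℝ), a) ((0 : ℝ), b) = 0) →
      a = 0 := fun a ha => hH a fun b => by rw [fibreHessian_apply]; exact ha b
  obtain ⟨U, hUo, ht₀U, ξ, hξ, hξ₀, hξcrit⟩ := exists_fibrewiseCriticalSection hf hcrit hH'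
  have hξcrit' : ∀ t ∈ U, ∀ a : 𝔼 3, fderiv ℝ f (t, ξ t) ((0 : ℝ), a) = 0 := fun t ht =>
    (fibreGrad_eq_zero_iff f _).1 (hξcrit t ht)
  -- Step 2: the cut-off family `g`
  obtain ⟨V, g, hVo, ht₀V, hVU, hg, hg0, hg1, hgV⟩ := exists_cutoffFamily hf hUo ht₀U hξ hξcrit'
  have hgt₀ : ∀ u, g (t₀, u) = f (t₀, w₀ + u) - f (t₀, w₀) := fun u => by
    rw [hgV t₀ ht₀V u, hξ₀]
  have hHg : fibreHessian g (t₀, 0) = fibreHessian f (t₀, w₀) :=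
    fibreHessian_eq_of_eq_translate hg hf hgt₀
  have hHgnd : ∀ a : 𝔼 3, (∀ b, fibreHessian g (t₀, 0) a b = 0) → a = 0 := by
    rw [hHg]
    exact hH
  -- Step 3: fibrewise Morse coordinates of `g`
  obtain ⟨W, y, Λ, hWo, hW₀, hys, hy0, hyd, hgy⟩ := exists_fibrewiseMorseCoords hg hg0 hg1 hHgnd
  rw [hHg] at hgy
  set σ : ℕ := sigNeg (((fibreHessian f (t₀, w₀)).toBilinForm).toQuadraticMap) with hσ
  -- Step 5: data for the chart assembly
  have hPc : ∀ i : Fin 4, ContDiff ℝ ∞ fun q : 𝔼 4 => q i := fun i =>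
    (EuclideanSpace.proj i : 𝔼 4 →L[ℝ] ℝ).contDiff
  have hPd : ∀ i : Fin 4,
      HasFDerivAt (fun q : 𝔼 4 => q i) (EuclideanSpace.proj i : 𝔼 4 →L[ℝ] ℝ) x :=
    fun i => (EuclideanSpace.proj i : 𝔼 4 →L[ℝ] ℝ).hasFDerivAt
  have hVU' : ContDiffOn ℝ ∞ ξ V := hξ.mono hVU
  set c : ℝ → ℝ := fun t => f (t, ξ t) with hc_def
  have hcs : ContDiffOn ℝ ∞ c V := hf.comp_contDiffOn (contDiffOn_id.prodMk hVU')
  set ι : 𝔼 4 → ℝ × 𝔼 3 := fun q => (q 0, fibrePart q - ξ (q 0)) with hι_def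
  have hV4o : IsOpen {q : 𝔼 4 | q 0 ∈ V} := hVo.preimage (hPc 0).continuous
  have hιs : ContDiffOn ℝ ∞ ι {q : 𝔼 4 | q 0 ∈ V} :=
    (hPc 0).contDiffOn.prodMk (fibrePart.contDiff.contDiffOn.sub
      (hVU'.comp (hPc 0).contDiffOn fun q hq => hq))
  set O : Set (𝔼 4) := {q | q 0 ∈ V} ∩ ι ⁻¹' W with hO_def
  have hOo : IsOpen O := hιs.continuousOn.isOpen_inter_preimage hV4o hWo
  have hxι : ι x = (t₀, 0) := by
    show ((x 0, fibrePart x - ξ (x 0)) : ℝ × 𝔼 3) = (t₀, 0)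
    rw [← ht₀_def, hξ₀, ← hw₀_def, sub_self]
  have hxO : x ∈ O := ⟨ht₀V, by show ι x ∈ W; rw [hxι]; exact hW₀⟩
  have hOV : ∀ q ∈ O, q 0 ∈ V := fun q hq => hq.1
  -- `f = c + g ∘ ι` on `O`, and the normal form of `g`
  have hfq : ∀ q ∈ O, f (q 0, fibrePart q) = c (q 0) + g (ι q) := fun q hq => by
    rw [hgV (q 0) hq.1]
    simp [hc_def]
  -- derivative of `y ∘ ι` at `x`
  have hyD : HasFDerivAt y (fderiv ℝ y (t₀, 0)) (t₀, 0) :=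
    ((hys.contDiffAt (hWo.mem_nhds hW₀)).differentiableAt (by simp)).hasFDerivAt
  have hyΛ : (fderiv ℝ y (t₀, 0)).comp (ContinuousLinearMap.inr ℝ ℝ (𝔼 3)) =
      (Λ : 𝔼 3 →L[ℝ] 𝔼 3) := by
    rw [← Literature.Analysis.Calculus.fderiv_partial_snd hyD.differentiableAt, hyd.fderiv]
  have hξd : HasDerivAt ξ (deriv ξ t₀) t₀ :=
    ((hVU'.contDiffAt (hVo.mem_nhds ht₀V)).differentiableAt (by simp)).hasDerivAt
  set ι' : 𝔼 4 →L[ℝ] ℝ × 𝔼 3 := (EuclideanSpace.proj (0 : Fin 4) : 𝔼 4 →L[ℝ] ℝ).prod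
    (fibrePart - ((1 : ℝ →L[ℝ] ℝ).smulRight (deriv ξ t₀)).comp
      (EuclideanSpace.proj (0 : Fin 4) : 𝔼 4 →L[ℝ] ℝ)) with hι'
  have hιd : HasFDerivAt ι ι' x :=
    (hPd 0).prodMk (fibrePart.hasFDerivAt.sub (hξd.hasFDerivAt.comp x (hPd 0)))
  have hyD' : HasFDerivAt y (fderiv ℝ y (t₀, 0)) (ι x) := by
    rw [hxι]
    exact hyD
  have hyιd : HasFDerivAt (fun q => y (ι q)) ((fderiv ℝ y (t₀, 0)).comp ι') x :=
    hyD'.comp x hιd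
  have hι'v : ∀ v : 𝔼 4, v 0 = 0 → ι' v = ContinuousLinearMap.inr ℝ ℝ (𝔼 3) (fibrePart v) := by
    intro v hv
    refine Prod.ext ?_ ?_
    · simpa [hι'] using hv
    · simp [hι', hv]
  have hinj0 : ∀ v : 𝔼 4, v 0 = 0 → (fderiv ℝ y (t₀, 0)).comp ι' v = 0 → v = 0 := by
    intro v hv h
    rw [ContinuousLinearMap.comp_apply, hι'v v hv, ← ContinuousLinearMap.comp_apply, hyΛ] at h
    have hfp : fibrePart v = 0 := by
      apply Λ.injective
      rw [map_zero]
      exact h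
    ext i
    refine Fin.cases ?_ (fun j => ?_) i
    · simpa using hv
    · have := congrArg (fun w : 𝔼 3 => w j) hfp
      simpa using this
  have hFc : Continuous (fibredMap f) := (contDiff_fibredMap hf).continuous
  have hF0 : ∀ q ∈ O, fibredMap f q 0 = q 0 := fun q _ => fibredMap_apply_zero f q
  have hyιs : ContDiffOn ℝ ∞ (fun q => y (ι q)) O :=
    hys.comp (hιs.mono inter_subset_left) fun q hq => hq.2
  have hyιx : y (ι x) = 0 := by
    rw [hxι]
    exact hy0 t₀ hW₀
  -- Step 6: the signs
  set s : Fin 3 → ℝ := fun i => if i.val < σ then -1 else 1 with hs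
  have hs2 : ∀ i, s i ^ 2 = 1 := fun i => by
    simp only [hs]
    split_ifs <;> norm_num
  have hsum : ∀ a : 𝔼 3,
      -∑ i ∈ Finset.univ.filter (fun i : Fin 3 => i.val < σ), (a i) ^ 2 +
          ∑ i ∈ Finset.univ.filter (fun i : Fin 3 => σ ≤ i.val), (a i) ^ 2 =
        s 0 * a 0 ^ 2 + s 1 * a 1 ^ 2 + s 2 * a 2 ^ 2 := by
    intro a
    have h1 : -∑ i ∈ Finset.univ.filter (fun i : Fin 3 => i.val < σ), (a i) ^ 2 +
        ∑ i ∈ Finset.univ.filter (fun i : Fin 3 => σ ≤ i.val), (a i) ^ 2 =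
          ∑ i : Fin 3, s i * a i ^ 2 := by
      rw [Finset.sum_filter, Finset.sum_filter, ← Finset.sum_neg_distrib, ← Finset.sum_add_distrib]
      refine Finset.sum_congr rfl fun i _ => ?_
      simp only [hs]
      by_cases h : i.val < σ
      · simp [h, not_le.2 h]
      · simp [h, not_lt.1 h]
    rw [h1, Fin.sum_univ_three]
  refine ⟨s 0, s 1, s 2, hs2 0, hs2 1, hs2 2, ?_⟩
  refine hasFoldChartSig_of_fibreCoords hFc hOo hxO (Y := fun q => y (ι q)) hyιs hyιx hyιd hinj0
    hVo hOV hcs (s 0) (s 1) (s 2) hF0 fun q hq => ?_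
  rw [fibredMap_apply_one, hfq q hq, hgy (ι q) hq.2, hsum]

end Literature.Topology.FourManifolds
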